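import Summits.RiemannHypothesis.RiemannHypothesis.Theorems.Splittings.ScrewGradedFloor
import HarnessLib

/-!
# Splittings — the GRADED SCREW FLOOR dictionary, §§2–6 (cell rh-split, seat (screw, bridge), gen 9)

CARVE (cell rh-split, lead RULING #89, referee rh-split-ref-2 g2 11:08:51Z): §§2–6 of seat (screw, bridge) g9's
`ScrewGradedFloor.lean` (sha16 4aa81474636fe141, 617 l), lines 316–617 VERBATIM except ONE declared dedup repair
(`norm_cosh_le_exp_abs_re` made `private`: its twin is landed in `LaplaceLoopholeResidueSeries`; used only by
`norm_term_le_of_strip` here); §1 (`gradedLandau`, F ⇒ Z) is `Splittings/ScrewGradedFloor.lean`, whose namespace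
`…Theorems.Splittings.ScrewGradedFloor` this file RE-OPENS so that the stub-closing names (`omegaDepth`, `stub_omegaDepth` =
VERBATIM the registered stub `Sig.stub_omegaDepth` of line power-sparse-detect on crux `IntegerScrew.ScrewPolyFloor`,
stmt-RiemannHypothesis-15757) keep the fully-qualified names the referee checked.

Contents: §2 the zero side (Z ⇒ A: `abs_zetaScrew_le_of_strip`, `abs_zetaScrew_le_exp_of_strip` from the unconditional zero
series for `Ψ = zetaScrew`); §3 the dictionary with the printed quasi-Riemann hypothesis (`quasiRH_iff_exp_floor`,
`quasiRH_iff_abs_le_exp`, `strip_iff_exp_floor`); §4 the graded NODE floor (`quasiRH_iff_node_floor`); §5 RH corollaries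
(`rh_iff_subpower_node_slack`, `subexpSlackDetect`, `rh_iff_subexp_floor`); §6 `omegaDepth` / `stub_omegaDepth`.
See the §1 module for the full mathematical docstring (Suzuki2023 Thms 1.1/1.6/1.7; Iwaniec–Kowalski §5.7; Titchmarsh §14).

HONEST LABEL: «DICTIONARY ROW (RH-free equivalence quasi-RH(½+η) ⟺ graded screw floor), not a splitting; a splitting
A ∧ B ⟹ RH is CONDITIONAL bookkeeping unless A and B are both proved; nothing here bears on the truth of RH.»
`Summit.RiemannHypothesis` is by definition Mathlib's `RiemannHypothesis` (`Summit.RiemannHypothesis_iff`).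
Zero `def`s; imports only tree modules; axioms standard (propext, Classical.choice, Quot.sound).
-/

noncomputable section

set_option linter.dupNamespace false

open Complex Filter Topology Set MeasureTheory

namespace Summit.RiemannHypothesis.RiemannHypothesis.Theorems.Splittings.ScrewGradedFloor

open Literature.NumberTheory.LFunctions
open Literature.NumberTheory.LFunctions.ZetaScrewLandau
open ZetaZeros.riemannZetaNontrivialZeros

/-! ## 2. The zero side (Z ⇒ A): a zero-free strip bounds `|Ψ|` by `S·(e^{η|t|}+1)/2` -/

/-- `‖cosh w‖ ≤ e^{|Re w|}`. -/
private theorem norm_cosh_le_exp_abs_re (w : ℂ) : ‖Complex.cosh w‖ ≤ Real.exp |w.re| := by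
  have h : Complex.cosh w = (Complex.exp w + Complex.exp (-w)) / 2 := rfl
  rw [h, norm_div, RCLike.norm_two]
  have h1 : ‖Complex.exp w‖ ≤ Real.exp |w.re| := by
    rw [Complex.norm_exp]
    exact Real.exp_le_exp.2 (le_abs_self _)
  have h2 : ‖Complex.exp (-w)‖ ≤ Real.exp |w.re| := by
    rw [Complex.norm_exp, neg_re]
    exact Real.exp_le_exp.2 (neg_le_abs _)
  have h3 : ‖Complex.exp w + Complex.exp (-w)‖ ≤ ‖Complex.exp w‖ + ‖Complex.exp (-w)‖ := norm_add_le _ _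
  linarith

/-- Termwise bound in the zero series under the strip hypothesis `|Re ρ - 1/2| ≤ η`:
`‖m(ρ)(cosh((ρ-1/2)t) - 1)/(ρ-1/2)²‖ ≤ (e^{η|t|}+1)/2 · 2m(ρ)/γ²`. -/
theorem norm_term_le_of_strip {η : ℝ}
    (hstrip : ∀ ρ : ℂ, ρ ∈ ZetaZeros.riemannZetaNontrivialZeros → |ρ.re - 1 / 2| ≤ η)
    (ρ : ZetaZeros.riemannZetaNontrivialZeros) (t : ℝ) :
    ‖(riemannZetaZeroOrder (ρ : ℂ) : ℂ) *
        ((Complex.cosh (((ρ : ℂ) - 1 / 2) * t) - 1) / ((ρ : ℂ) - 1 / 2) ^ 2)‖ ≤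
      (Real.exp (η * |t|) + 1) / 2 * (2 * (riemannZetaZeroOrder (ρ : ℂ) : ℝ) / (ρ : ℂ).im ^ 2) := by
  have hm := FordL33.order_pos ρ
  have hγ : (ρ : ℂ).im ≠ 0 := im_ne_zero ρ.2
  have hγ2 : 0 < (ρ : ℂ).im ^ 2 := by positivity
  have hρ := hstrip (ρ : ℂ) ρ.2
  -- the numerator
  have hre : ((((ρ : ℂ) - 1 / 2) * t).re) = ((ρ : ℂ).re - 1 / 2) * t := by
    simp [sub_re, mul_re]
  have hnum : ‖Complex.cosh (((ρ : ℂ) - 1 / 2) * t) - 1‖ ≤ Real.exp (η * |t|) + 1 := by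
    have h1 : ‖Complex.cosh (((ρ : ℂ) - 1 / 2) * t)‖ ≤ Real.exp (η * |t|) := by
      refine (norm_cosh_le_exp_abs_re _).trans (Real.exp_le_exp.2 ?_)
      rw [hre, abs_mul]
      exact mul_le_mul_of_nonneg_right hρ (abs_nonneg t)
    calc ‖Complex.cosh (((ρ : ℂ) - 1 / 2) * t) - 1‖
        ≤ ‖Complex.cosh (((ρ : ℂ) - 1 / 2) * t)‖ + ‖(1 : ℂ)‖ := norm_sub_le _ _
      _ ≤ Real.exp (η * |t|) + 1 := by rw [norm_one]; linarith
  -- the denominator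
  have hden : (ρ : ℂ).im ^ 2 ≤ ‖((ρ : ℂ) - 1 / 2) ^ 2‖ := by
    rw [norm_pow]
    have him : (((ρ : ℂ) - 1 / 2).im) = (ρ : ℂ).im := by simp [sub_im]
    have h := Complex.abs_im_le_norm ((ρ : ℂ) - 1 / 2)
    rw [him] at h
    have h' : |(ρ : ℂ).im| ^ 2 ≤ ‖(ρ : ℂ) - 1 / 2‖ ^ 2 := pow_le_pow_left₀ (abs_nonneg _) h 2
    rwa [sq_abs] at h'
  have hA : 0 ≤ Real.exp (η * |t|) + 1 := by positivity
  rw [norm_mul, norm_div, Complex.norm_intCast, abs_of_pos hm]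
  have hfrac : ‖Complex.cosh (((ρ : ℂ) - 1 / 2) * t) - 1‖ / ‖((ρ : ℂ) - 1 / 2) ^ 2‖ ≤
      (Real.exp (η * |t|) + 1) / (ρ : ℂ).im ^ 2 :=
    div_le_div₀ hA hnum hγ2 hden
  calc (riemannZetaZeroOrder (ρ : ℂ) : ℝ) *
        (‖Complex.cosh (((ρ : ℂ) - 1 / 2) * t) - 1‖ / ‖((ρ : ℂ) - 1 / 2) ^ 2‖)
      ≤ (riemannZetaZeroOrder (ρ : ℂ) : ℝ) * ((Real.exp (η * |t|) + 1) / (ρ : ℂ).im ^ 2) :=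
        mul_le_mul_of_nonneg_left hfrac hm.le
    _ = (Real.exp (η * |t|) + 1) / 2 * (2 * (riemannZetaZeroOrder (ρ : ℂ) : ℝ) / (ρ : ℂ).im ^ 2) := by
        ring

/-- **Zero side.** If every non-trivial zero satisfies `|Re ρ - 1/2| ≤ η` then
`|Ψ(t)| ≤ (e^{η|t|}+1)/2 · Σ_ρ 2m(ρ)/γ²` for every real `t` (the unconditional zero series
`Suzuki2023_thm11_series_holds`; at `η = 0` = RH this is `ZetaScrewGrowth.abs_zetaScrew_le_of_RH`). -/
theorem abs_zetaScrew_le_of_strip {η : ℝ}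
    (hstrip : ∀ ρ : ℂ, ρ ∈ ZetaZeros.riemannZetaNontrivialZeros → |ρ.re - 1 / 2| ≤ η) (t : ℝ) :
    |zetaScrew t| ≤ (Real.exp (η * |t|) + 1) / 2 *
      ∑' ρ : ZetaZeros.riemannZetaNontrivialZeros,
        2 * (riemannZetaZeroOrder (ρ : ℂ) : ℝ) / (ρ : ℂ).im ^ 2 := by
  have hsum := Suzuki2023_thm11_series_holds t
  have hS := ZetaScrewGrowth.summable_two_mul_order_div_im_sq.hasSum.mul_left
    ((Real.exp (η * |t|) + 1) / 2)
  have h := tsum_of_norm_bounded hS (fun ρ ↦ norm_term_le_of_strip hstrip ρ t)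
  rw [hsum.tsum_eq, Complex.norm_real, Real.norm_eq_abs] at h
  exact h

/-- **Zero side, clean constant** (`η ≥ 0`): a zero-free strip gives `|Ψ(t)| ≤ S e^{η|t|}` for all `t`. -/
theorem abs_zetaScrew_le_exp_of_strip {η : ℝ} (hη : 0 ≤ η)
    (hstrip : ∀ ρ : ℂ, ρ ∈ ZetaZeros.riemannZetaNontrivialZeros → |ρ.re - 1 / 2| ≤ η) :
    ∃ S : ℝ, 0 ≤ S ∧ ∀ t : ℝ, |zetaScrew t| ≤ S * Real.exp (η * |t|) := by
  set S : ℝ := ∑' ρ : ZetaZeros.riemannZetaNontrivialZeros,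
    2 * (riemannZetaZeroOrder (ρ : ℂ) : ℝ) / (ρ : ℂ).im ^ 2 with hS_def
  have hS0 : 0 ≤ S := by
    refine tsum_nonneg fun ρ ↦ ?_
    have hm := FordL33.order_pos ρ
    positivity
  refine ⟨S, hS0, fun t ↦ ?_⟩
  have h := abs_zetaScrew_le_of_strip hstrip t
  have he : 1 ≤ Real.exp (η * |t|) := Real.one_le_exp (by positivity)
  have h2 : (Real.exp (η * |t|) + 1) / 2 ≤ Real.exp (η * |t|) := by linarith
  calc |zetaScrew t| ≤ (Real.exp (η * |t|) + 1) / 2 * S := h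
    _ ≤ Real.exp (η * |t|) * S := mul_le_mul_of_nonneg_right h2 hS0
    _ = S * Real.exp (η * |t|) := mul_comm _ _

/-! ## 3. The dictionary with the quasi-Riemann hypothesis -/

/-- `QuasiRiemannHypothesis (1/2 + η)` puts every non-trivial zero in the strip `|Re ρ - 1/2| ≤ η`
(symmetry `ρ ↦ 1 - ρ`, `GeneralizedRH.riemannZeta_one_sub_eq_zero`). -/
theorem strip_of_quasiRH {η : ℝ} (hq : QuasiRiemannHypothesis (1 / 2 + η)) :
    ∀ ρ : ℂ, ρ ∈ ZetaZeros.riemannZetaNontrivialZeros → |ρ.re - 1 / 2| ≤ η := by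
  intro ρ hρ
  have hζ := zeta_eq_zero hρ
  have h0 := re_pos hρ
  have h1 := re_lt_one hρ
  rw [abs_le]
  constructor
  · by_contra h
    push Not at h
    refine hq (1 - ρ) (GeneralizedRH.riemannZeta_one_sub_eq_zero hζ h0 h1) ?_ ?_
    · simp only [sub_re, one_re]; linarith
    · simp only [sub_re, one_re]; linarith
  · by_contra h
    push Not at h
    exact hq ρ hζ (by linarith) h1

/-- No zeros of `ξ(1/2 + ·)` on `Re w > η` (`η ≥ 0`) is `QuasiRiemannHypothesis (1/2 + η)`
(`riemannXi_eq_zero_iff_holds`: the zeros of `ξ` are the zeros of `ζ` in `0 < Re s < 1`). -/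
theorem quasiRH_of_xi_ne_zero {η : ℝ} (hη : 0 ≤ η)
    (h : ∀ w₀ : ℂ, η < w₀.re → riemannXi (1 / 2 + w₀) ≠ 0) :
    QuasiRiemannHypothesis (1 / 2 + η) := by
  intro s hs h1 h2
  have hξ : riemannXi s = 0 := (riemannXi_eq_zero_iff_holds s).2 ⟨hs, by linarith, h2⟩
  have hw : η < (s - 1 / 2).re := by simp; linarith
  refine h (s - 1 / 2) hw ?_
  rw [show (1 / 2 : ℂ) + (s - 1 / 2) = s by ring]
  exact hξ

/-- Conversely `QuasiRiemannHypothesis (1/2 + η)` clears `ξ(1/2 + ·)` on `Re w > η`. -/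
theorem xi_ne_zero_of_quasiRH {η : ℝ} (hq : QuasiRiemannHypothesis (1 / 2 + η)) :
    ∀ w₀ : ℂ, η < w₀.re → riemannXi (1 / 2 + w₀) ≠ 0 := by
  intro w₀ hw₀ h0
  obtain ⟨hζ, _, h1⟩ := (riemannXi_eq_zero_iff_holds _).1 h0
  exact hq _ hζ (by simp; linarith) h1

/-- **THE GRADED DICTIONARY, (Z) ⟺ (F)** (`η ≥ 0`): `QuasiRiemannHypothesis (1/2 + η)` iff `Ψ` has
the graded floor `Ψ(t) ≥ -K e^{ηt}` on `[0, ∞)`.  (`η = 0`: RH ⟺ `Ψ` bounded below on `[0,∞)`,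
Suzuki2023 Thm 1.6/1.7.) -/
theorem quasiRH_iff_exp_floor {η : ℝ} (hη : 0 ≤ η) :
    QuasiRiemannHypothesis (1 / 2 + η) ↔
      ∃ K : ℝ, ∀ t : ℝ, 0 ≤ t → -K * Real.exp (η * t) ≤ zetaScrew t := by
  constructor
  · intro hq
    obtain ⟨S, _, hS⟩ := abs_zetaScrew_le_exp_of_strip hη (strip_of_quasiRH hq)
    refine ⟨S, fun t ht ↦ ?_⟩
    have h := hS t
    rw [abs_of_nonneg ht] at h
    have h' := (abs_le.1 h).1
    linarith
  · rintro ⟨K, hK⟩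
    exact quasiRH_of_xi_ne_zero hη (gradedLandau hη hK)

/-- **(Z) ⟺ (A)** (`η ≥ 0`): `QuasiRiemannHypothesis (1/2 + η)` iff `|Ψ(t)| ≤ K e^{η|t|}` on `ℝ`. -/
theorem quasiRH_iff_abs_le_exp {η : ℝ} (hη : 0 ≤ η) :
    QuasiRiemannHypothesis (1 / 2 + η) ↔
      ∃ K : ℝ, ∀ t : ℝ, |zetaScrew t| ≤ K * Real.exp (η * |t|) := by
  constructor
  · intro hq
    obtain ⟨S, _, hS⟩ := abs_zetaScrew_le_exp_of_strip hη (strip_of_quasiRH hq)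
    exact ⟨S, hS⟩
  · rintro ⟨K, hK⟩
    refine (quasiRH_iff_exp_floor hη).2 ⟨K, fun t ht ↦ ?_⟩
    have h := hK t
    rw [abs_of_nonneg ht] at h
    have h' := (abs_le.1 h).1
    linarith

/-- **(Z) as a strip ⟺ (F)** (`η ≥ 0`), the form without the `QuasiRiemannHypothesis` wrapper. -/
theorem strip_iff_exp_floor {η : ℝ} (hη : 0 ≤ η) :
    (∀ ρ : ℂ, ρ ∈ ZetaZeros.riemannZetaNontrivialZeros → |ρ.re - 1 / 2| ≤ η) ↔
      ∃ K : ℝ, ∀ t : ℝ, 0 ≤ t → -K * Real.exp (η * t) ≤ zetaScrew t := by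
  constructor
  · intro hstrip
    obtain ⟨S, _, hS⟩ := abs_zetaScrew_le_exp_of_strip hη hstrip
    refine ⟨S, fun t ht ↦ ?_⟩
    have h := hS t
    rw [abs_of_nonneg ht] at h
    have h' := (abs_le.1 h).1
    linarith
  · intro h
    exact strip_of_quasiRH ((quasiRH_iff_exp_floor hη).2 h)

/-! ## 4. The graded NODE floor (integer sampling, `nodeSlack`) -/

/-- **(Z) ⟺ (N)** (`η ≥ 0`): `QuasiRiemannHypothesis (1/2 + η)` iff `Ψ(log m) ≥ -K m^η` for all
`m ≥ 1`.  (`⇐`: the node `⌊e^t⌋` loses at most `nodeSlack = 6`, and `m^η ≤ e^{ηt}`.) -/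
theorem quasiRH_iff_node_floor {η : ℝ} (hη : 0 ≤ η) :
    QuasiRiemannHypothesis (1 / 2 + η) ↔
      ∃ K : ℝ, ∀ m : ℕ, 1 ≤ m → -K * (m : ℝ) ^ η ≤ zetaScrew (Real.log m) := by
  constructor
  · intro hq
    obtain ⟨K, hK⟩ := (quasiRH_iff_exp_floor hη).1 hq
    refine ⟨K, fun m hm ↦ ?_⟩
    have hm0 : (0 : ℝ) < m := by exact_mod_cast hm
    have hm1 : (1 : ℝ) ≤ m := by exact_mod_cast hm
    have h := hK (Real.log m) (Real.log_nonneg hm1)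
    rwa [show Real.exp (η * Real.log m) = (m : ℝ) ^ η by
      rw [Real.rpow_def_of_pos hm0, mul_comm]] at h
  · rintro ⟨K, hK⟩
    obtain ⟨K₆, hK₆⟩ := IntegerScrewDiscreteLandau.nodeSlack
    refine (quasiRH_iff_exp_floor hη).2 ⟨max K 0 + |K₆|, fun t ht ↦ ?_⟩
    set m : ℕ := ⌊Real.exp t⌋₊ with hm_def
    have hm1 : 1 ≤ m := (Nat.one_le_floor_iff _).2 (Real.one_le_exp ht)
    have hm0 : (0 : ℝ) ≤ m := by positivity
    have hmle : (m : ℝ) ≤ Real.exp t := Nat.floor_le (Real.exp_pos t).le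
    have hmexp : (m : ℝ) ^ η ≤ Real.exp (η * t) := by
      calc (m : ℝ) ^ η ≤ (Real.exp t) ^ η := Real.rpow_le_rpow hm0 hmle hη
        _ = Real.exp (η * t) := by rw [← Real.exp_mul, mul_comm]
    have hnode := hK m hm1
    have hslack := hK₆ t ht
    have hrpow0 : 0 ≤ (m : ℝ) ^ η := Real.rpow_nonneg hm0 η
    have h1 : K * (m : ℝ) ^ η ≤ max K 0 * Real.exp (η * t) :=
      calc K * (m : ℝ) ^ η ≤ max K 0 * (m : ℝ) ^ η :=
            mul_le_mul_of_nonneg_right (le_max_left _ _) hrpow0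
        _ ≤ max K 0 * Real.exp (η * t) := mul_le_mul_of_nonneg_left hmexp (le_max_right _ _)
    have h2 : K₆ ≤ |K₆| * Real.exp (η * t) :=
      calc K₆ ≤ |K₆| := le_abs_self _
        _ = |K₆| * 1 := (mul_one _).symm
        _ ≤ |K₆| * Real.exp (η * t) :=
            mul_le_mul_of_nonneg_left (Real.one_le_exp (by positivity)) (abs_nonneg _)
    have h3 : -K * (m : ℝ) ^ η ≤ zetaScrew (Real.log m) := hnode
    nlinarith [h1, h2, h3, hslack]

/-! ## 5. RH corollaries: sub-power slack at the nodes -/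

/-- `QuasiRiemannHypothesis (1/2 + ε)` for every `ε > 0` is RH. -/
theorem rh_of_forall_quasiRH (h : ∀ ε : ℝ, 0 < ε → QuasiRiemannHypothesis (1 / 2 + ε)) :
    Summit.RiemannHypothesis := by
  refine quasiRiemannHypothesis_one_half_iff_holds.1 fun s hs h1 h2 ↦ ?_
  exact h ((s.re - 1 / 2) / 2) (by linarith) s hs (by linarith) h2

/-- **RH ⟺ SUB-POWER NODE SLACK**: RH iff for every `ε > 0` there is `K_ε` with `Ψ(log m) ≥ -K_ε m^ε`
for all `m ≥ 1` (`DiscreteLandau` = constant slack; here every sub-power slack suffices). -/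
theorem rh_iff_subpower_node_slack :
    Summit.RiemannHypothesis ↔
      ∀ ε : ℝ, 0 < ε → ∃ K : ℝ, ∀ m : ℕ, 1 ≤ m → -K * (m : ℝ) ^ ε ≤ zetaScrew (Real.log m) := by
  constructor
  · intro hRH ε _
    exact ⟨0, fun m _ ↦ by simpa using ZetaScrewThm17.zetaScrew_nonneg_of_RH hRH _⟩
  · intro h
    exact rh_of_forall_quasiRH fun ε hε ↦ (quasiRH_iff_node_floor hε.le).2 (h ε hε)

/-- = `Theses.SparseScrew.SubexpSlackDetect` of line power-sparse-detect (Cruxes/ScrewPolyFloor/Lines/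
PowerSparseDetect.lean), now a theorem: sub-power slack at the integer nodes for every `ε > 0` ⟹ RH. -/
theorem subexpSlackDetect :
    (∀ ε : ℝ, 0 < ε → ∃ K : ℝ, ∀ m : ℕ, 1 ≤ m →
        -K * (m : ℝ) ^ ε ≤ Literature.NumberTheory.LFunctions.zetaScrew (Real.log m)) →
      Summit.RiemannHypothesis :=
  rh_iff_subpower_node_slack.2

/-- **RH ⟺ SUB-EXPONENTIAL FLOOR**: RH iff for every `ε > 0`, `Ψ(t) ≥ -K_ε e^{εt}` on `[0, ∞)`. -/
theorem rh_iff_subexp_floor :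
    Summit.RiemannHypothesis ↔
      ∀ ε : ℝ, 0 < ε → ∃ K : ℝ, ∀ t : ℝ, 0 ≤ t → -K * Real.exp (ε * t) ≤ zetaScrew t := by
  constructor
  · intro hRH ε _
    exact ⟨0, fun t _ ↦ by simpa using ZetaScrewThm17.zetaScrew_nonneg_of_RH hRH t⟩
  · intro h
    exact rh_of_forall_quasiRH fun ε hε ↦ (quasiRH_iff_exp_floor hε.le).2 (h ε hε)

/-! ## 6. The registered stub `stub_omegaDepth` (line power-sparse-detect, stmt-RiemannHypothesis-15757) -/

/-- **Ω-DEPTH** — VERBATIM the statement `Cruxes.ScrewPolyFloor.PowerSparseDetect.Sig.stub_omegaDepth`: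
a zero of `ζ` with `1/2 + η < Re ρ < 1` (`η ≥ 0`) forces `Ψ(t) < -K e^{ηt}` at some `t ≥ max(T,0)`, for
every `K` and `T` (contrapositive of `gradedLandau`, after absorbing the compact range `[0, T]` into `K`
by continuity of `Ψ`). -/
theorem omegaDepth :
    ∀ η : ℝ, 0 ≤ η → (∃ ρ : ℂ, riemannZeta ρ = 0 ∧ 1 / 2 + η < ρ.re ∧ ρ.re < 1) →
      ∀ K T : ℝ, ∃ t : ℝ, T ≤ t ∧ 0 ≤ t ∧ zetaScrew t < -K * Real.exp (η * t) := by
  intro η hη hρ K T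
  obtain ⟨ρ, hζ, h1, h2⟩ := hρ
  by_contra hcon
  push Not at hcon
  -- `Ψ` is bounded below on the compact `[0, max T 0]`
  obtain ⟨B, hB⟩ := (isCompact_Icc (a := (0 : ℝ)) (b := max T 0)).bddBelow_image
    continuous_zetaScrew.continuousOn
  have hBle : ∀ t : ℝ, 0 ≤ t → t ≤ max T 0 → B ≤ zetaScrew t := fun t h0 hT ↦
    hB (Set.mem_image_of_mem _ ⟨h0, hT⟩)
  have hfloor : ∀ t : ℝ, 0 ≤ t → -(max K 0 + |B|) * Real.exp (η * t) ≤ zetaScrew t := by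
    intro t ht
    have he : 1 ≤ Real.exp (η * t) := Real.one_le_exp (by positivity)
    have hK0 : 0 ≤ max K 0 := le_max_right _ _
    rcases le_or_gt T t with hT | hT
    · have h := hcon t hT ht
      have h1' : K * Real.exp (η * t) ≤ max K 0 * Real.exp (η * t) :=
        mul_le_mul_of_nonneg_right (le_max_left _ _) (Real.exp_pos _).le
      nlinarith [abs_nonneg B, h, h1']
    · have h := hBle t ht ((le_of_lt hT).trans (le_max_left _ _))
      have h2' : |B| ≤ |B| * Real.exp (η * t) := by
        calc |B| = |B| * 1 := (mul_one _).symm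
          _ ≤ |B| * Real.exp (η * t) := mul_le_mul_of_nonneg_left he (abs_nonneg _)
      nlinarith [neg_abs_le B, h, h2', hK0, Real.exp_pos (η * t)]
  have hq : QuasiRiemannHypothesis (1 / 2 + η) := (quasiRH_iff_exp_floor hη).2 ⟨_, hfloor⟩
  exact hq ρ hζ h1 h2


/-- Alias under the registered stub's own name (skeleton of stmt-RiemannHypothesis-15757, line
power-sparse-detect): `stub_omegaDepth`. -/
theorem stub_omegaDepth :
    ∀ η : ℝ, 0 ≤ η → (∃ ρ : ℂ, riemannZeta ρ = 0 ∧ 1 / 2 + η < ρ.re ∧ ρ.re < 1) →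
      ∀ K T : ℝ, ∃ t : ℝ, T ≤ t ∧ 0 ≤ t ∧ zetaScrew t < -K * Real.exp (η * t) :=
  omegaDepth

end Summit.RiemannHypothesis.RiemannHypothesis.Theorems.Splittings.ScrewGradedFloor

end
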